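import Mathlib.AlgebraicGeometry.EllipticCurve.Affine.Point
import Mathlib.RingTheory.Valuation.Basic
import HarnessLib

/-!
# Levels of the points reducing to the node on `y² + xy = x³ + a₄x + a₆` over a valued field

Topic `NumberTheory/EllipticCurves`. Let `(L, w)` be a field with a valuation (any value group
`Γ₀`) and `T : y² + xy = x³ + a₄x + a₆` a Weierstrass equation over `L` with `|a₄| ≤ |a₆| < 1`
(`Literature.NumberTheory.EllipticCurves.TateForm.IsTateForm w T`): the shape of the Tate curve
`E_q : y² + xy = x³ + a₄(q)x + a₆(q)`, `|a₄(q)| ≤ |a₆(q)| = |q|` (Silverman, *ATAEC*, V.3,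
Thm. 3.1: `a₄(q), a₆(q) ∈ qℤ⟦q⟧`, `a₆(q) = -q + ⋯`; `a₄(q) = -5q - ⋯` may be smaller in residue
characteristic `5`) and of the curve `y² + xy = x³ - 36x/(j - 1728) - 1/(j - 1728)` of `j`-invariant `j`
when `|j| > 1` (Silverman, *AEC*, proof of Prop. III.1.4(c); Mathlib `WeierstrassCurve.ofJNe0Or1728`
up to scaling). The equation is `w`-integral and reduces to the nodal cubic `y² + xy = x³`, whose
node is `(0, 0)`; the points of `T(L)` reducing to the node are the affine points with `|x| < 1`
("small" points, `TateForm.IsSmall`; then also `|y| < 1`, `TateForm.w_y_lt_one`), the others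
(`𝒪` and `|x| ≥ 1`) are the points of `E₀` (nonsingular reduction).

This file proves, by ultrametric estimates on the chord–tangent formulas (Silverman, *AEC*,
III.2.3) and nothing else — no Hensel, no completeness, no discreteness — the part of the
structure of `T(L)/T₀(L)` (Silverman, *ATAEC*, V.4, Lemmas 4.1.1–4.1.4 and Cor. IV.9.2(d): for
the Tate curve over a complete field, `E_q(K)/E_{q,0}(K)` is cyclic of order `v(q)`, the class of
`φ(u)` being `v(u) mod v(q)`) that bounds the number of `E₀`-classes *from above*:

* `TateForm.branch`: a small point `P = (x, y)` with `|x|² > |a₆|` ("non-middle") lies on exactly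
  one of the two branches of the node: `|y| < |x| = |y + x|` (branch of the tangent `y = 0`) or
  `|y + x| < |x| = |y|` (branch of the tangent `y = -x`);
* `TateForm.not_isSmall_sub_of_branch₀`, `TateForm.not_isSmall_sub_of_branch₁`: two non-middle
  small points on the same branch with the same `|x|` ("same level") differ by a point of `E₀`
  (their difference is `𝒪` or has `|x| ≥ 1`);
* `TateForm.not_isSmall_two_nsmul_of_middle`: a small point with `|x|² ≤ |a₆|` ("middle":
  on `E_q` these are the points of the component of order `2`) has `2P ∈ E₀`.

In Tate's parametrisation `P = φ(u)`, `0 < v(u) < v(q)`: `x ≈ u + q/u`, so the level is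
`min(v(u), v(q) - v(u))` and the branch tells `v(u) < v(q)/2` from `v(u) > v(q)/2`; the three
statements are the elementary shadow of "`φ(u) ≡ φ(u')` modulo `E₀` iff `v(u) = v(u')`".
Consumer: `PotentiallyMultiplicativeRamifiedTorsion` (an elliptic curve over a number field
with `ord_v(j) < 0` has ramified `ℓ`-torsion at `v` for every large odd `ℓ`: the `ℓ`-torsion
meets at most `2·ord_v(1/j)` classes modulo `E₀`, each of size `≤ ℓ`), on the way to the
criterion of Néron–Ogg–Shafarevich for isogenous curves (Silverman, *AEC*, Cor. VII.7.2,
`WeierstrassCurve.IsIsogenous.badPlaces_eq`).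

Relation to the tree: `Literature.NumberTheory.EllipticCurves.SplitMultiplicativeIndex` treats
the special case `a₄ = 0` over a completion `K_v` (`TateNormalForm.IsTateNormalForm`, `IsBig`)
and proves the *lower* bound (`n` pairwise incongruent points, by Hensel's lemma); the present
file is the valued-field, `a₄ ≠ 0` companion giving the congruences (upper bound), which is what
the torsion argument needs. `lean search` (2026-08-14): no other treatment of `E/E₀` for nodal
reduction (`KodairaNeron*` record the finiteness of `E(K)/E₀(K)` as named facts).

## References

* [SilvermanATAEC1994] J. H. Silverman, *Advanced Topics in the Arithmetic of Elliptic Curves*,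
  GTM 151, Springer 1994: V.3 Thm. 3.1 (the Tate curve), V.4 Lemma 4.1.1–4.1.4 (PDF pp. 402–405),
  Cor. IV.9.2(d).
* [SilvermanAEC2009] J. H. Silverman, *The Arithmetic of Elliptic Curves*, 2nd ed., GTM 106,
  Springer 2009: III.2.3 (group law algorithm), proof of Prop. III.1.4(c) (the curve with
  given `j`), VII.2 (reduction, `E₀`, `E₁`), proof of Thm. VII.7.1.

## Design

Plain valued field `(L, w)`, `w : Valuation L Γ₀` with an arbitrary
`LinearOrderedCommGroupWithZero Γ₀` (the consumer uses the `ℝ≥0`-valued spectral valuation of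
`K̄_v`). Two definitions (`IsTateForm`, a `Prop`-valued structure, and `IsSmall`), theorems
otherwise; the group law needs `[DecidableEq L]` exactly as Mathlib's
`WeierstrassCurve.Affine.Point` API. Namespace `Literature.NumberTheory.EllipticCurves.TateForm`.
-/

namespace Literature.NumberTheory.EllipticCurves

namespace TateForm

variable {L : Type*} [Field L] {Γ₀ : Type*} [LinearOrderedCommGroupWithZero Γ₀]
  (w : Valuation L Γ₀) (T : WeierstrassCurve L)

/-- `T` is in *Tate form* for the valuation `w`: `y² + xy = x³ + a₄x + a₆` (`a₁ = 1`,
`a₂ = a₃ = 0`) with `|a₄| ≤ |a₆| < 1` — the shape of the Tate curve `E_q` (Silverman, *ATAEC*,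
V.3 Thm. 3.1: `a₄(q), a₆(q) ∈ qℤ⟦q⟧`, so `|a₄(q)| ≤ |a₆(q)| = |q| < 1`). Such an equation is
`w`-integral and reduces to the nodal cubic `y² + xy = x³` with node `(0, 0)` and tangents `y = 0`, `y = -x`.
[cite: SilvermanATAEC1994, V.3 Thm. 3.1] -/
structure IsTateForm : Prop where
  a₁ : T.a₁ = 1
  a₂ : T.a₂ = 0
  a₃ : T.a₃ = 0
  w_a₄_le : w T.a₄ ≤ w T.a₆
  w_a₆_lt : w T.a₆ < 1

variable {T} in
/-- A point of `T(L)` is *small* if it is an affine point `(x, y)` with `|x| < 1`, i.e. (for `T`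
in Tate form) it reduces to the node `(0, 0)` of `y² + xy = x³`; `𝒪` and the affine points with
`|x| ≥ 1` (the points of `E₀`, Silverman, *AEC*, VII.2; *ATAEC*, Lemma V.4.1.1) are not small.
[cite: SilvermanATAEC1994, Lemma V.4.1.1 (PDF p. 402)] -/
def IsSmall : T.toAffine.Point → Prop
  | .zero => False
  | @WeierstrassCurve.Affine.Point.some _ _ _ x _ _ => w x < 1

variable {w T}

/-- `𝒪` is not small (by definition). [folklore] -/
@[simp]
theorem not_isSmall_zero : ¬ IsSmall w (0 : T.toAffine.Point) := fun h => h

/-- An affine point is small iff `|x| < 1` (by definition). [folklore] -/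
@[simp]
theorem isSmall_some {x y : L} (h : T.toAffine.Nonsingular x y) :
    IsSmall w (.some x y h) ↔ w x < 1 := Iff.rfl

/-- The equation of a curve in Tate form: `y² + xy = x³ + a₄x + a₆`. [folklore] -/
theorem IsTateForm.equation_iff (hT : IsTateForm w T) (x y : L) :
    T.toAffine.Equation x y ↔ y ^ 2 + x * y = x ^ 3 + T.a₄ * x + T.a₆ := by
  rw [WeierstrassCurve.Affine.equation_iff, hT.a₁, hT.a₂, hT.a₃]
  constructor <;> intro h <;> linear_combination h

/-- `negY` in Tate form: `-(x, y) = (x, -y - x)`. [folklore] -/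
theorem IsTateForm.negY (hT : IsTateForm w T) (x y : L) : T.toAffine.negY x y = -y - x := by
  rw [WeierstrassCurve.Affine.negY, hT.a₁, hT.a₃]
  ring

/-- `addX` in Tate form: `x(P + Q) = λ(λ + 1) - (x₁ + x₂)`. [folklore] -/
theorem IsTateForm.addX (hT : IsTateForm w T) (x₁ x₂ S : L) :
    T.toAffine.addX x₁ x₂ S = S * (S + 1) - (x₁ + x₂) := by
  rw [WeierstrassCurve.Affine.addX, hT.a₁, hT.a₂]
  ring

/-- `0 < |a₆|` and `|a₆| < 1` for a Tate form with `a₆ ≠ 0`. [folklore] -/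
theorem IsTateForm.w_a₆_pos (_hT : IsTateForm w T) (ha₆ : T.a₆ ≠ 0) : 0 < w T.a₆ :=
  (Valuation.pos_iff _).mpr ha₆

/-! ## Valuation bookkeeping -/

/-- If `|D| ≤ |N|`, `|D| ≤ |N + D|`, `D ≠ 0` and `|c| < 1`, then for `λ = N/D` one has
`|λ(λ + 1) - c| ≥ 1`: indeed `|λ| ≥ 1` and `|λ + 1| = |(N + D)/D| ≥ 1`. This is the shape of
`x(P + Q) = λ(λ + 1) - (x₁ + x₂)` on `y² + xy = x³ + ⋯`. [folklore] -/
theorem one_le_w_level_aux {N D c : L} (hD : D ≠ 0) (hN : w D ≤ w N) (hND : w D ≤ w (N + D))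
    (hc : w c < 1) : 1 ≤ w (N / D * (N / D + 1) - c) := by
  have hD0 : 0 < w D := (Valuation.pos_iff _).mpr hD
  have h1 : 1 ≤ w (N / D) := by
    rw [map_div₀, le_div_iff₀ hD0, one_mul]
    exact hN
  have h2 : 1 ≤ w (N / D + 1) := by
    rw [show N / D + 1 = (N + D) / D by field_simp, map_div₀, le_div_iff₀ hD0, one_mul]
    exact hND
  have h12 : 1 ≤ w (N / D * (N / D + 1)) := by
    rw [map_mul]
    exact Left.one_le_mul h1 h2
  rw [Valuation.map_sub_eq_of_lt_left _ (lt_of_lt_of_le hc h12)]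
  exact h12

/-! ## Small points -/

/-- On a Tate form, a point with `|x| < 1` has `|y| < 1` (if `|y| ≥ 1` then `y²` strictly
dominates `xy`, `x³`, `a₄x`, `a₆`). Silverman, *ATAEC*, Lemma V.4.1.1.
[cite: SilvermanATAEC1994, Lemma V.4.1.1 (PDF p. 402)] -/
theorem w_y_lt_one (hT : IsTateForm w T) {x y : L} (h : T.toAffine.Equation x y)
    (hx : w x < 1) : w y < 1 := by
  by_contra hy
  rw [not_lt] at hy
  rw [hT.equation_iff] at h
  have hy0 : 0 < w y := lt_of_lt_of_le zero_lt_one hy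
  have hy2 : 1 ≤ w (y ^ 2) := by
    rw [map_pow]
    exact one_le_pow₀ hy
  have h1 : w (x * y) < w (y ^ 2) := by
    rw [map_mul, map_pow, sq]
    calc w x * w y < 1 * w y := mul_lt_mul_of_pos_right hx hy0
      _ = w y := one_mul _
      _ ≤ w y * w y := le_mul_of_one_le_left (le_of_lt hy0) hy
  have h2 : w (x ^ 3 + T.a₄ * x + T.a₆) < w (y ^ 2) := by
    refine Valuation.map_add_lt _ (Valuation.map_add_lt _ ?_ ?_) (lt_of_lt_of_le hT.w_a₆_lt hy2)
    · rw [map_pow]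
      exact lt_of_lt_of_le (pow_lt_one₀ zero_le hx three_ne_zero) hy2
    · rw [map_mul]
      refine lt_of_lt_of_le ?_ hy2
      calc w T.a₄ * w x ≤ 1 * w x :=
            mul_le_mul_left (hT.w_a₄_le.trans hT.w_a₆_lt.le) _
        _ = w x := one_mul _
        _ < 1 := hx
  have h3 : w (y ^ 2 + x * y) = w (y ^ 2) := Valuation.map_add_eq_of_lt_left _ h1
  rw [h] at h3
  exact h2.ne h3

/-- On a Tate form, for a small point `(x, y)`: `|y| · |y + x| = |x³ + a₄x + a₆| < |x|²`
when `|a₆| < |x|²` (then `|x³| < |x|²`, `|a₄x| < |x|²`). [folklore] -/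
theorem w_y_mul_w_add_lt_sq (hT : IsTateForm w T) {x y : L} (h : T.toAffine.Equation x y)
    (hx : w x < 1) (hmid : w T.a₆ < w x ^ 2) : w y * w (y + x) < w x ^ 2 := by
  rw [hT.equation_iff] at h
  have hx0 : 0 < w x := by
    refine lt_of_le_of_ne zero_le fun h0 => ?_
    rw [← h0, zero_pow two_ne_zero] at hmid
    exact not_lt_zero hmid
  have hxy : y * (y + x) = x ^ 3 + T.a₄ * x + T.a₆ := by linear_combination h
  rw [← map_mul, hxy]
  refine Valuation.map_add_lt _ (Valuation.map_add_lt _ ?_ ?_) hmid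
  · rw [map_pow]
    calc w x ^ 3 = w x ^ 2 * w x := pow_succ (w x) 2
      _ < w x ^ 2 * 1 := mul_lt_mul_of_pos_left hx (pow_pos hx0 2)
      _ = w x ^ 2 := mul_one _
  · rw [map_mul]
    calc w T.a₄ * w x ≤ w T.a₆ * w x := mul_le_mul_left hT.w_a₄_le _
      _ < w x ^ 2 * w x := mul_lt_mul_of_pos_right hmid hx0
      _ ≤ w x ^ 2 := by
          calc w x ^ 2 * w x ≤ w x ^ 2 * 1 := mul_le_mul_right hx.le _
            _ = w x ^ 2 := mul_one _

/-- `0 < |x|` for a non-middle small point (`|a₆| < |x|²`). [folklore] -/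
theorem w_x_pos_of_lt_sq {x : L} (hmid : w T.a₆ < w x ^ 2) : 0 < w x := by
  refine lt_of_le_of_ne zero_le fun h0 => ?_
  rw [← h0, zero_pow two_ne_zero] at hmid
  exact not_lt_zero hmid

/-! ## The two branches of the node -/

/-- **The two branches.** On a Tate form, a small point `(x, y)` with `|a₆| < |x|²` satisfies
exactly one of: `|y| < |x|` (and then `|y + x| = |x|`) — the branch of the tangent `y = 0` at
the node — or `|y + x| < |x|` (and then `|y| = |x|`) — the branch of the tangent `y = -x`.
Indeed `|y|·|y + x| = |x³ + a₄x + a₆| < |x|²` while `max(|y|, |y + x|) ≥ |x|`. On the Tate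
curve `E_q`, `φ(u)` with `0 < v(u) < v(q)/2` lies on the first branch and `φ(u)` with
`v(q)/2 < v(u) < v(q)` on the second (Silverman, *ATAEC*, V.4, Lemmas 4.1.2–4.1.4).
[cite: SilvermanATAEC1994, V.4 Lemmas 4.1.2–4.1.4 (PDF pp. 403–405)] -/
theorem branch (hT : IsTateForm w T) {x y : L} (h : T.toAffine.Equation x y) (hx : w x < 1)
    (hmid : w T.a₆ < w x ^ 2) :
    (w y < w x ∧ w (y + x) = w x) ∨ (w (y + x) < w x ∧ w y = w x) := by
  have key := w_y_mul_w_add_lt_sq hT h hx hmid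
  rcases lt_trichotomy (w y) (w (y + x)) with hlt | heq | hgt
  · have hxv : w x = w (y + x) := by
      have := Valuation.map_sub_eq_of_lt_left w hlt
      rwa [add_sub_cancel_left] at this
    exact Or.inl ⟨hxv ▸ hlt, hxv.symm⟩
  · exfalso
    have hle : w x ≤ w y := by
      have := Valuation.map_sub w (y + x) y
      rwa [add_sub_cancel_left, ← heq, max_self] at this
    have : w x ^ 2 ≤ w y * w (y + x) := by
      rw [← heq, sq]
      exact mul_le_mul' hle hle
    exact absurd key (not_lt.mpr this)
  · have hxv : w x = w y := by
      have := Valuation.map_sub_eq_of_lt_right w hgt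
      rwa [add_sub_cancel_left] at this
    exact Or.inr ⟨hxv ▸ hgt, hxv.symm⟩

/-- The two branches are disjoint: `|y| < |x|` and `|y + x| < |x|` cannot both hold
(`x = (y + x) - y`). [folklore] -/
theorem not_branch₁_of_branch₀ {x y : L} (hy : w y < w x) : ¬ w (y + x) < w x := by
  intro hyx
  have := Valuation.map_sub w (y + x) y
  rw [add_sub_cancel_left] at this
  exact absurd this (not_le.mpr (max_lt hyx hy))

/-- Two affine points of a Tate form with the same `x`-coordinate have `y₂ = y₁` or
`y₁ + y₂ + x = 0` (the two roots of the Weierstrass polynomial at `x`; a restatement of Mathlib's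
`WeierstrassCurve.Affine.Y_eq_of_X_eq` with `negY = -y - x`). [folklore] -/
theorem y_eq_or_eq_neg_of_x_eq (hT : IsTateForm w T) {x y₁ y₂ : L}
    (h₁ : T.toAffine.Equation x y₁) (h₂ : T.toAffine.Equation x y₂) :
    y₂ = y₁ ∨ y₁ + y₂ + x = 0 := by
  rcases WeierstrassCurve.Affine.Y_eq_of_X_eq h₂ h₁ rfl with h | h
  · exact Or.inl h
  · right
    rw [hT.negY] at h
    linear_combination h

/-- `|3| ≤ 1` for any valuation. [folklore] -/
theorem w_three_le_one : w (3 : L) ≤ 1 := by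
  have h := Valuation.map_add_le w (Valuation.map_add_le w (le_of_eq w.map_one)
    (le_of_eq w.map_one)) (le_of_eq w.map_one)
  norm_num at h
  exact h

section GroupLaw

variable [DecidableEq L]

/-- **Same level on the branch `y = 0` ⟹ congruent modulo `E₀`.** On a Tate form, let
`P = (x₁, y₁)`, `Q = (x₂, y₂)` be small points on the first branch (`|yᵢ| < |xᵢ|`) with
`|x₁| = |x₂|`. Then `P - Q` is not small (it is `𝒪` or has `|x| ≥ 1`): if `x₁ = x₂` then
`P = Q`; otherwise the chord through `P` and `-Q = (x₂, -y₂ - x₂)` has slope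
`λ = (y₁ + y₂ + x₂)/(x₁ - x₂)` with `|y₁ + y₂ + x₂| = |x₂| ≥ |x₁ - x₂|` and
`λ + 1 = (y₁ + y₂ + x₁)/(x₁ - x₂)`, so `|λ|, |λ + 1| ≥ 1` and `|x(P - Q)| = |λ(λ + 1)| ≥ 1`.
(On `E_q`: `φ(u) - φ(u') ∈ E₀` when `v(u) = v(u') < v(q)/2`; Silverman, *ATAEC*, V.4,
Lemma 4.1.2 and Cor. IV.9.2(d).) [cite: SilvermanATAEC1994, V.4 Lemma 4.1.2 (PDF p. 403)] -/
theorem not_isSmall_sub_of_branch₀ (hT : IsTateForm w T) {x₁ y₁ x₂ y₂ : L}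
    (h₁ : T.toAffine.Nonsingular x₁ y₁) (h₂ : T.toAffine.Nonsingular x₂ y₂)
    (hx : w x₁ = w x₂) (hx1 : w x₁ < 1) (hy₁ : w y₁ < w x₁) (hy₂ : w y₂ < w x₂) :
    ¬ IsSmall w (.some x₁ y₁ h₁ - .some x₂ y₂ h₂) := by
  have hy12 : w (y₁ + y₂) < w x₂ := Valuation.map_add_lt _ (hx ▸ hy₁) hy₂
  rw [sub_eq_add_neg, WeierstrassCurve.Affine.Point.neg_some]
  by_cases hxe : x₁ = x₂
  · subst hxe
    rcases y_eq_or_eq_neg_of_x_eq hT h₁.1 h₂.1 with hy | hy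
    · subst hy
      rw [WeierstrassCurve.Affine.Point.add_of_Y_eq rfl
        (by rw [WeierstrassCurve.Affine.negY_negY])]
      exact not_isSmall_zero
    · exfalso
      have : y₁ + y₂ = -x₁ := by linear_combination hy
      rw [this, Valuation.map_neg] at hy12
      exact lt_irrefl _ hy12
  · rw [WeierstrassCurve.Affine.Point.add_of_X_ne hxe, isSmall_some, not_lt, hT.addX,
      WeierstrassCurve.Affine.slope_of_X_ne hxe, hT.negY,
      show y₁ - (-y₂ - x₂) = y₁ + y₂ + x₂ by ring]
    have hN : w (y₁ + y₂ + x₂) = w x₂ := Valuation.map_add_eq_of_lt_right _ hy12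
    have hND : w (y₁ + y₂ + x₂ + (x₁ - x₂)) = w x₁ := by
      rw [show y₁ + y₂ + x₂ + (x₁ - x₂) = y₁ + y₂ + x₁ by ring]
      exact Valuation.map_add_eq_of_lt_right _ (hx.symm ▸ hy12)
    have hD : w (x₁ - x₂) ≤ w x₂ := Valuation.map_sub_le _ hx.le le_rfl
    exact one_le_w_level_aux (sub_ne_zero.mpr hxe) (hN ▸ hD) (hND ▸ hx ▸ hD)
      (Valuation.map_add_lt _ hx1 (hx ▸ hx1))

/-- **Same level on the branch `y = -x` ⟹ congruent modulo `E₀`.** On a Tate form, let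
`P = (x₁, y₁)`, `Q = (x₂, y₂)` be small points on the second branch (`|yᵢ + xᵢ| < |xᵢ|`) with
`|x₁| = |x₂|`. Then `P - Q` is not small: as for the first branch, now with
`y₁ + y₂ + x₂ = (y₁ + x₁) + (y₂ + x₂) - x₁` of absolute value `|x₁|`. (On `E_q`:
`v(q)/2 < v(u) = v(u') < v(q)`; Silverman, *ATAEC*, V.4, Lemma 4.1.2 and Cor. IV.9.2(d).)
[cite: SilvermanATAEC1994, V.4 Lemma 4.1.2 (PDF p. 403)] -/
theorem not_isSmall_sub_of_branch₁ (hT : IsTateForm w T) {x₁ y₁ x₂ y₂ : L}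
    (h₁ : T.toAffine.Nonsingular x₁ y₁) (h₂ : T.toAffine.Nonsingular x₂ y₂)
    (hx : w x₁ = w x₂) (hx1 : w x₁ < 1) (hy₁ : w (y₁ + x₁) < w x₁) (hy₂ : w (y₂ + x₂) < w x₂) :
    ¬ IsSmall w (.some x₁ y₁ h₁ - .some x₂ y₂ h₂) := by
  have hy12 : w (y₁ + x₁ + (y₂ + x₂)) < w x₁ := Valuation.map_add_lt _ hy₁ (hx.symm ▸ hy₂)
  rw [sub_eq_add_neg, WeierstrassCurve.Affine.Point.neg_some]
  by_cases hxe : x₁ = x₂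
  · subst hxe
    rcases y_eq_or_eq_neg_of_x_eq hT h₁.1 h₂.1 with hy | hy
    · subst hy
      rw [WeierstrassCurve.Affine.Point.add_of_Y_eq rfl
        (by rw [WeierstrassCurve.Affine.negY_negY])]
      exact not_isSmall_zero
    · exfalso
      have : y₁ + x₁ + (y₂ + x₁) = x₁ := by linear_combination hy
      rw [this] at hy12
      exact lt_irrefl _ hy12
  · rw [WeierstrassCurve.Affine.Point.add_of_X_ne hxe, isSmall_some, not_lt, hT.addX,
      WeierstrassCurve.Affine.slope_of_X_ne hxe, hT.negY,
      show y₁ - (-y₂ - x₂) = y₁ + y₂ + x₂ by ring]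
    have hN : w (y₁ + y₂ + x₂) = w x₁ := by
      rw [show y₁ + y₂ + x₂ = y₁ + x₁ + (y₂ + x₂) - x₁ by ring]
      exact Valuation.map_sub_eq_of_lt_right _ hy12
    have hND : w (y₁ + y₂ + x₂ + (x₁ - x₂)) = w x₂ := by
      rw [show y₁ + y₂ + x₂ + (x₁ - x₂) = y₁ + x₁ + (y₂ + x₂) - x₂ by ring]
      exact Valuation.map_sub_eq_of_lt_right _ (hx ▸ hy12)
    have hD : w (x₁ - x₂) ≤ w x₂ := Valuation.map_sub_le _ hx.le le_rfl
    exact one_le_w_level_aux (sub_ne_zero.mpr hxe) (hN ▸ hx ▸ hD) (hND ▸ hD)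
      (Valuation.map_add_lt _ hx1 (hx ▸ hx1))

/-- **Middle points have `2P ∈ E₀`.** On a Tate form with `a₆ ≠ 0`, a small point `P = (x, y)`
with `|x|² ≤ |a₆|` satisfies `|y| = |y + x|`, `|y|² = |a₆|`, and `2P` is not small: the tangent
has slope `λ = (3x² + a₄ - y)/(2y + x)` with `|3x² + a₄ - y| = |y| ≥ |2y + x|` and
`λ + 1 = (3x² + a₄ + y + x)/(2y + x)`, so `|x(2P)| = |λ(λ + 1)| ≥ 1` (or `2P = 𝒪`). (On `E_q`
these are the `φ(u)` with `v(u) = v(q)/2`, the component of order `2` of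
`E_q(K)/E_{q,0}(K) ≅ ℤ/v(q)ℤ`; Silverman, *ATAEC*, V.4 Lemma 4.1.4 and Cor. IV.9.2(d).)
[cite: SilvermanATAEC1994, V.4 Lemma 4.1.4 (PDF p. 405)] -/
theorem not_isSmall_two_nsmul_of_middle (hT : IsTateForm w T) (ha₆ : T.a₆ ≠ 0) {x y : L}
    (h : T.toAffine.Nonsingular x y) (hx : w x < 1) (hmid : w x ^ 2 ≤ w T.a₆) :
    ¬ IsSmall w (.some x y h + .some x y h) := by
  have e := (hT.equation_iff x y).mp h.1
  have ha0 : 0 < w T.a₆ := hT.w_a₆_pos ha₆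
  -- `|y| · |y + x| = |a₆|`
  have hprod : w y * w (y + x) = w T.a₆ := by
    rw [← map_mul, show y * (y + x) = x ^ 3 + T.a₄ * x + T.a₆ by linear_combination e]
    refine Valuation.map_add_eq_of_lt_right _ (Valuation.map_add_lt _ ?_ ?_)
    · rw [map_pow]
      calc w x ^ 3 = w x ^ 2 * w x := pow_succ (w x) 2
        _ ≤ w T.a₆ * w x := mul_le_mul_left hmid _
        _ < w T.a₆ := by
            calc w T.a₆ * w x < w T.a₆ * 1 := mul_lt_mul_of_pos_left hx ha0
              _ = w T.a₆ := mul_one _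
    · rw [map_mul]
      calc w T.a₄ * w x ≤ w T.a₆ * w x := mul_le_mul_left hT.w_a₄_le _
        _ < w T.a₆ * 1 := mul_lt_mul_of_pos_left hx ha0
        _ = w T.a₆ := mul_one _
  -- `|y| = |y + x|`
  have hαβ : w y = w (y + x) := by
    by_contra hne
    rcases lt_or_gt_of_ne hne with hlt | hgt
    · have hxv : w x = w (y + x) := by
        have := Valuation.map_sub_eq_of_lt_left w hlt
        rwa [add_sub_cancel_left] at this
      have hpos : 0 < w (y + x) := lt_of_le_of_lt zero_le hlt
      have : w y * w (y + x) < w (y + x) * w (y + x) := mul_lt_mul_of_pos_right hlt hpos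
      rw [hprod, ← hxv, ← sq] at this
      exact absurd hmid (not_le.mpr this)
    · have hxv : w x = w y := by
        have := Valuation.map_sub_eq_of_lt_right w hgt
        rwa [add_sub_cancel_left] at this
      have hpos : 0 < w y := lt_of_le_of_lt zero_le hgt
      have : w y * w (y + x) < w y * w y := mul_lt_mul_of_pos_left hgt hpos
      rw [hprod, ← hxv, ← sq] at this
      exact absurd hmid (not_le.mpr this)
  have hα2 : w y * w y = w T.a₆ := by rw [← hprod, ← hαβ]
  have hα0 : 0 < w y := by
    refine lt_of_le_of_ne zero_le fun h0 => ?_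
    rw [← h0, zero_mul] at hα2
    exact ha0.ne hα2
  have hα1 : w y < 1 := by
    by_contra hge
    rw [not_lt] at hge
    have : 1 ≤ w y * w y := Left.one_le_mul hge hge
    rw [hα2] at this
    exact absurd hT.w_a₆_lt (not_lt.mpr this)
  -- `|a₆| < |y|`, `|x|² < |y|`, `|a₄| < |y|`
  have ha₆y : w T.a₆ < w y := by
    rw [← hα2]
    exact mul_lt_of_lt_one_left hα0 hα1
  by_cases hneg : y = T.toAffine.negY x y
  · rw [WeierstrassCurve.Affine.Point.add_of_Y_eq rfl hneg]
    exact not_isSmall_zero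
  · rw [WeierstrassCurve.Affine.Point.add_self_of_Y_ne hneg, isSmall_some, not_lt, hT.addX,
      WeierstrassCurve.Affine.slope_of_Y_ne rfl hneg, hT.negY, hT.a₁, hT.a₂,
      show (3 * x ^ 2 + 2 * 0 * x + T.a₄ - 1 * y) = 3 * x ^ 2 + T.a₄ - y by ring,
      show y - (-y - x) = y + (y + x) by ring]
    have h3x : w (3 * x ^ 2 + T.a₄) < w y := by
      refine Valuation.map_add_lt _ ?_ (hT.w_a₄_le.trans_lt ha₆y)
      rw [map_mul, map_pow]
      calc w 3 * w x ^ 2 ≤ 1 * w x ^ 2 := mul_le_mul_left w_three_le_one _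
        _ = w x ^ 2 := one_mul _
        _ ≤ w T.a₆ := hmid
        _ < w y := ha₆y
    have hN : w (3 * x ^ 2 + T.a₄ - y) = w y := Valuation.map_sub_eq_of_lt_right _ h3x
    have hND : w (3 * x ^ 2 + T.a₄ - y + (y + (y + x))) = w y := by
      rw [show 3 * x ^ 2 + T.a₄ - y + (y + (y + x)) = 3 * x ^ 2 + T.a₄ + (y + x) by ring, hαβ]
      exact Valuation.map_add_eq_of_lt_right _ (hαβ ▸ h3x)
    have hD : w (y + (y + x)) ≤ w y := Valuation.map_add_le _ le_rfl hαβ.symm.le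
    have hD0 : y + (y + x) ≠ 0 := by
      intro h0
      apply hneg
      rw [hT.negY]
      linear_combination h0
    exact one_le_w_level_aux hD0 (hN ▸ hD) (hND ▸ hD)
      (Valuation.map_add_lt _ hx hx)

end GroupLaw

end TateForm

end Literature.NumberTheory.EllipticCurves
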